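import Summits.BirchSwinnertonDyer.Rank1Residual.Additive.CensusX42Height
import Literature.NumberTheory.EllipticCurves.NoEverywhereGoodReductionRat
import Literature.NumberTheory.EllipticCurves.CanonicalPAdicHeightJunkSigmaProofs
import Literature.NumberTheory.EllipticCurves.CanonicalPAdicHeightThetaProofs
import Literature.NumberTheory.EllipticCurves.PadicPointsFiniteIndexProofs
import Literature.NumberTheory.EllipticCurves.QuadraticTwist
import HarnessLib

/-!
# Route `CyclotomicUntwist`, crux K1 `PSRankOneLowerHalfAtThree` (stmt-BirchSwinnertonDyer-21580):
# the σ-LINE FAMILY — the census's TRANSPORTED MAZUR–TATE CONSTANT `c_E` IS `p`-INTEGRAL on the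
# census scope (`p ≥ 5`, `W = C • V^{(±p)}`, `V` with good reduction at `p`, `c₄(W)c₆(W) ≠ 0`)

Cell `pub/bsd-wall` (D-0145 line `route-BirchSwinnertonDyer-CyclotomicUntwist`), seat `bsd-line-cycu-p1`
g5, lane «σ-LINE FAMILY LAW — LEVEL-ONE DATUM», file 28 of the lane. THEOREMS ONLY (no definition, no
named fact, no `sorry`); helper `--supports` K1 = stmt-BirchSwinnertonDyer-21580. BSD is not proved by
this file and no crux is.

WHAT. The census X4-2 height is the σ_{c_E}-height for `c_E = CensusX42.transportedSigmaConst W p V =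
U²·(c_{E♭} − b₂(E♭)/12) + b₂(E)/12`, `U² = (c₆(E)/c₆(E♭))·(c₄(E♭)/c₄(E))`, `c_{E♭} = padicSigmaConst` of
the globally minimal twist `V = E♭`. The level-one datum (`…LevelOneDatum`, `…CensusHeight`) needs
`‖c_E‖_p ≤ 1`; here it is PROVED on the census scope of `RelationAtCensusHeight`:

* `norm_padicSigmaConst_le_one` — `‖c_{E♭}‖_p ≤ 1` always (the Mazur–Tate pair has `c ∈ ℤ_p`; junk `0`);
* `norm_b₂_le_one`, `norm_ratCast_b₂_le_one`, `norm_ratCast_Δ_le_one` — integrality bookkeeping;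
* `norm_ratCast_Δ_eq_one_of_hasGoodReductionAtPrime` — `‖Δ(V)‖_p = 1` for `V` globally minimal with good
  reduction at `p`;
* `norm_inv_u_le_one_of_twist` — for `W = C • V^{(d)}` with `W` integral, `‖Δ(V)‖_p = 1`, `‖d‖_p = p⁻¹`:
  `‖u⁻¹‖_p ≤ 1` (`Δ(W) = u⁻¹² d⁶ Δ(V)`, norms are integral powers of `p`);
* `twistRatio_eq` — `U² = u⁻²·d` when `c₄(W)c₆(W) ≠ 0`; `norm_twistRatio_le` — `‖U²‖_p ≤ p⁻¹`;
* **`norm_transportedSigmaConst_le_one`** — `‖c_E‖_p ≤ 1` for `p ≥ 5`, `W` globally minimal with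
  `c₄(W) ≠ 0`, `c₆(W) ≠ 0`, `V` globally minimal with good reduction at `p`, `C • V^{(±p)} = W`.

References: Mazur–Stein–Tate 2006 Thm. 1.3 (`c ∈ ℤ_p`); Silverman AEC III.1 (`c₄, c₆, Δ` under `u`),
VII.1–VII.2, X.5 (twists); census memo X42-STEP0 §3. [cite: MazurSteinTate2006, Thm. 1.3]
[cite: SilvermanAEC2009, VII.1 Prop. 1.3]
-/

set_option autoImplicit false
-- single-conjunct summit: `Summit.BirchSwinnertonDyer.BirchSwinnertonDyer.…` repeats the name by design
set_option linter.dupNamespace false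

noncomputable section

open scoped Classical

open WeierstrassCurve Literature.NumberTheory.EllipticCurves
  Summit.BirchSwinnertonDyer.Rank1Residual.Additive

namespace Summit.BirchSwinnertonDyer.BirchSwinnertonDyer.Theorems.PSSigmaLineFamilyTransportedConstant

/-! ### §1 Integrality bookkeeping -/

section Local

variable {p : ℕ} [Fact p.Prime]

/-- **`‖c_p‖ ≤ 1`**: the Mazur–Tate constant `padicSigmaConst` of ANY `V/ℚ_p` is `p`-integral (a
Mazur–Tate pair has `c ∈ ℤ_p` by definition; the junk value is `0`). [cite: MazurSteinTate2006, Thm. 1.3] -/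
theorem norm_padicSigmaConst_le_one (V : WeierstrassCurve ℚ_[p]) : ‖V.padicSigmaConst‖ ≤ 1 := by
  by_cases h : ∃ σ : PowerSeries ℚ_[p], ∃ c : ℚ_[p], V.IsMazurTateSigmaPair σ c
  · exact (V.isMazurTateSigmaPair_padicSigma h).norm_const_le
  · rw [V.padicSigmaConst_eq_zero_of_not_exists h, norm_zero]; exact zero_le_one

/-- `‖b₂‖ ≤ 1` for a `p`-integral equation. [Silverman AEC III.1, VII.1] [cite: SilvermanAEC2009, VII.1 Prop. 1.3] -/
theorem norm_b₂_le_one (V : WeierstrassCurve ℚ_[p]) [V.IsIntegral ℤ_[p]] : ‖V.b₂‖ ≤ 1 := by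
  have hb : V.b₂ = ((V.integralModel ℤ_[p]).b₂ : ℚ_[p]) := by
    conv_lhs => rw [← V.eq_map_integralModel]
    rw [map_b₂]; rfl
  rw [hb]; exact PadicInt.norm_le_one _

/-- `‖b₂(W)‖_p ≤ 1` for `W/ℚ` with integer coefficients. [cite: SilvermanAEC2009, VII.1 Prop. 1.3] -/
theorem norm_ratCast_b₂_le_one (W : WeierstrassCurve ℚ) [W.IsIntegral ℤ] : ‖((W.b₂ : ℚ) : ℚ_[p])‖ ≤ 1 := by
  have h : ((W.b₂ : ℚ) : ℚ_[p]) = (W.baseChange ℚ_[p]).b₂ := by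
    rw [baseChange, map_b₂, eq_ratCast]
  rw [h]; exact norm_b₂_le_one _

/-- `‖Δ(W)‖_p ≤ 1` for `W/ℚ` with integer coefficients. [cite: SilvermanAEC2009, VII.1 Prop. 1.3] -/
theorem norm_ratCast_Δ_le_one (W : WeierstrassCurve ℚ) [W.IsIntegral ℤ] : ‖((W.Δ : ℚ) : ℚ_[p])‖ ≤ 1 := by
  have h : ((W.Δ : ℚ) : ℚ_[p]) = (W.baseChange ℚ_[p]).Δ := by
    rw [baseChange, map_Δ, eq_ratCast]
  rw [h]; exact norm_Δ_le_one _

/-- **`‖Δ(V)‖_p = 1` for `V/ℚ` globally minimal with good reduction at `p`** (`p ∤ Δ_min`).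
[Silverman AEC VII.5 Prop. 5.1(a)] [cite: SilvermanAEC2009, VII.5 Prop. 5.1(a)] -/
theorem norm_ratCast_Δ_eq_one_of_hasGoodReductionAtPrime (V : WeierstrassCurve ℚ) [V.IsGloballyMinimal]
    (hgood : V.HasGoodReductionAtPrime p) : ‖((V.Δ : ℚ) : ℚ_[p])‖ = 1 := by
  have hndvd : ¬ (p : ℤ) ∣ minimalDiscriminantInt V := fun h =>
    not_hasGoodReductionAtPrime_of_dvd_minimalDiscriminantInt V p h hgood
  have hcast : ((V.Δ : ℚ) : ℚ_[p]) = ((minimalDiscriminantInt V : ℤ) : ℚ_[p]) := by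
    rw [← cast_minimalDiscriminantInt V]; push_cast; rfl
  rw [hcast]
  refine le_antisymm (Padic.norm_int_le_one _) ?_
  by_contra hlt
  rw [not_le] at hlt
  exact hndvd (Padic.norm_intCast_lt_one_iff.mp hlt)

/-- `12` is a `p`-adic unit for `p ≥ 5`. [folklore] -/
theorem norm_twelve_eq_one (hp5 : 5 ≤ p) : ‖((12 : ℚ) : ℚ_[p])‖ = 1 := by
  have h12 : ((12 : ℚ) : ℚ_[p]) = ((12 : ℕ) : ℚ_[p]) := by push_cast; rfl
  rw [h12, Padic.norm_natCast_eq_one_iff]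
  have hp := (Fact.out : p.Prime)
  have hnd : ¬ p ∣ 12 := by
    intro h
    have hle : p ≤ 12 := Nat.le_of_dvd (by norm_num) h
    interval_cases p <;> first | exact absurd h (by decide) | exact absurd hp (by decide)
  exact (Nat.Prime.coprime_iff_not_dvd hp).mpr hnd

/-- `‖b₂/12‖_p ≤ 1` for `p ≥ 5` and integer coefficients. [folklore] -/
theorem norm_ratCast_b₂_div_twelve_le_one (hp5 : 5 ≤ p) (W : WeierstrassCurve ℚ) [W.IsIntegral ℤ] :
    ‖((W.b₂ / 12 : ℚ) : ℚ_[p])‖ ≤ 1 := by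
  rw [Rat.cast_div, norm_div, norm_twelve_eq_one hp5, div_one]
  exact norm_ratCast_b₂_le_one W

/-- Norms in `ℚ_p` are integral powers of `p`: `‖x‖^12 ≤ p^6 ⇒ ‖x‖ ≤ 1`. [folklore] -/
theorem norm_le_one_of_pow_twelve_le {x : ℚ_[p]} (h : ‖x‖ ^ 12 ≤ (p : ℝ) ^ 6) : ‖x‖ ≤ 1 := by
  have hp1 : (1 : ℝ) < p := by exact_mod_cast (Fact.out : p.Prime).one_lt
  by_contra hx
  rw [not_le] at hx
  -- `‖x‖ > 1 = p^0` forces `‖x‖ ≥ p`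
  have hge : (p : ℝ) ≤ ‖x‖ := by
    by_contra hlt
    rw [not_le] at hlt
    have := (Padic.norm_le_pow_iff_norm_lt_pow_add_one x 0).mpr (by simpa using hlt)
    rw [zpow_zero] at this
    exact absurd this (not_le.mpr hx)
  have h12 : (p : ℝ) ^ 12 ≤ ‖x‖ ^ 12 := pow_le_pow_left₀ (by positivity) hge 12
  have hlt : (p : ℝ) ^ 6 < (p : ℝ) ^ 12 := pow_lt_pow_right₀ hp1 (by norm_num)
  exact absurd (h12.trans h) (not_le.mpr hlt)

end Local

/-! ### §2 The twist relation `W = C • V^{(d)}` -/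

section Twist

variable {p : ℕ} [Fact p.Prime]

/-- **`‖u⁻¹‖_p ≤ 1`** for `W = C • V^{(d)}` with `W` integral, `‖Δ(V)‖_p = 1` and `‖d‖_p = p⁻¹`:
`Δ(W) = u⁻¹² d⁶ Δ(V)` has norm `≤ 1`, so `‖u⁻¹‖¹² ≤ p⁶`, and norms are integral powers of `p`.
[Silverman AEC III.1 Table 3.1, VII.1] [cite: SilvermanAEC2009, VII.1 Prop. 1.3] -/
theorem norm_inv_u_le_one_of_twist (W V : WeierstrassCurve ℚ) [W.IsIntegral ℤ] (C : VariableChange ℚ)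
    {d : ℚ} (hd : ‖(d : ℚ_[p])‖ = (p : ℝ)⁻¹) (hΔ : ‖((V.Δ : ℚ) : ℚ_[p])‖ = 1)
    (hC : C • V.quadraticTwist d = W) : ‖((((C.u : ℚˣ) : ℚ) : ℚ_[p]))⁻¹‖ ≤ 1 := by
  have hp0 : (0 : ℝ) < p := by exact_mod_cast (Fact.out : p.Prime).pos
  have hW : W.Δ = ((C.u⁻¹ : ℚˣ) : ℚ) ^ 12 * (d ^ 6 * V.Δ) := by
    rw [← hC, variableChange_Δ, quadraticTwist_Δ]
  have hle := norm_ratCast_Δ_le_one (p := p) W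
  rw [hW] at hle
  push_cast at hle
  rw [norm_mul, norm_mul, norm_pow, norm_pow, hd, hΔ, mul_one, inv_pow] at hle
  refine norm_le_one_of_pow_twelve_le ?_
  have h6 : (0 : ℝ) < (p : ℝ) ^ 6 := by positivity
  calc ‖((((C.u : ℚˣ) : ℚ) : ℚ_[p]))⁻¹‖ ^ 12
      = ‖((((C.u : ℚˣ) : ℚ) : ℚ_[p]))⁻¹‖ ^ 12 * ((p : ℝ) ^ 6)⁻¹ * (p : ℝ) ^ 6 := by
        rw [mul_assoc, inv_mul_cancel₀ h6.ne', mul_one]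
    _ ≤ 1 * (p : ℝ) ^ 6 := by gcongr
    _ = (p : ℝ) ^ 6 := one_mul _

/-- `c₄(V) ≠ 0` and `c₆(V) ≠ 0` when `W = C • V^{(d)}` has `c₄(W)c₆(W) ≠ 0`
(`c₄(W) = u⁻⁴d²c₄(V)`, `c₆(W) = u⁻⁶d³c₆(V)`). [cite: SilvermanAEC2009, III.1 Table 3.1] -/
theorem c₄_ne_zero_and_c₆_ne_zero_of_twist (W V : WeierstrassCurve ℚ) (C : VariableChange ℚ) {d : ℚ}
    (hC : C • V.quadraticTwist d = W) (h4 : W.c₄ ≠ 0) (h6 : W.c₆ ≠ 0) : V.c₄ ≠ 0 ∧ V.c₆ ≠ 0 := by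
  rw [← hC, variableChange_c₄, quadraticTwist_c₄] at h4
  rw [← hC, variableChange_c₆, quadraticTwist_c₆] at h6
  exact ⟨fun h => h4 (by rw [h, mul_zero, mul_zero]), fun h => h6 (by rw [h, mul_zero, mul_zero])⟩

/-- **`U² = u⁻²·d`**: for `W = C • V^{(d)}` with `c₄(W)c₆(W) ≠ 0`,
`(c₆(W)/c₆(V))·(c₄(V)/c₄(W)) = u⁻²d`. [Silverman AEC III.1 Table 3.1; census X42-STEP0 §3]
[cite: SilvermanAEC2009, III.1 Table 3.1] -/
theorem twistRatio_eq (W V : WeierstrassCurve ℚ) (C : VariableChange ℚ) {d : ℚ}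
    (hC : C • V.quadraticTwist d = W) (h4 : W.c₄ ≠ 0) (h6 : W.c₆ ≠ 0) :
    (W.c₆ / V.c₆) * (V.c₄ / W.c₄) = ((C.u⁻¹ : ℚˣ) : ℚ) ^ 2 * d := by
  obtain ⟨hV4, hV6⟩ := c₄_ne_zero_and_c₆_ne_zero_of_twist W V C hC h4 h6
  have hd : d ≠ 0 := by
    rintro rfl
    rw [← hC, variableChange_c₄, quadraticTwist_c₄] at h4
    exact h4 (by ring)
  have hu : ((C.u⁻¹ : ℚˣ) : ℚ) ≠ 0 := Units.ne_zero _
  have e4 : W.c₄ = ((C.u⁻¹ : ℚˣ) : ℚ) ^ 4 * (d ^ 2 * V.c₄) := by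
    rw [← hC, variableChange_c₄, quadraticTwist_c₄]
  have e6 : W.c₆ = ((C.u⁻¹ : ℚˣ) : ℚ) ^ 6 * (d ^ 3 * V.c₆) := by
    rw [← hC, variableChange_c₆, quadraticTwist_c₆]
  rw [e4, e6]
  field_simp

/-- **`‖U²‖_p ≤ p⁻¹ ≤ 1`** on the census scope: `W` integral, `‖Δ(V)‖_p = 1`, `‖d‖_p = p⁻¹`,
`c₄(W)c₆(W) ≠ 0`. [census X42-STEP0 §3] [cite: SilvermanAEC2009, III.1 Table 3.1] -/
theorem norm_twistRatio_le (W V : WeierstrassCurve ℚ) [W.IsIntegral ℤ] (C : VariableChange ℚ) {d : ℚ}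
    (hd : ‖(d : ℚ_[p])‖ = (p : ℝ)⁻¹) (hΔ : ‖((V.Δ : ℚ) : ℚ_[p])‖ = 1)
    (hC : C • V.quadraticTwist d = W) (h4 : W.c₄ ≠ 0) (h6 : W.c₆ ≠ 0) :
    ‖(((W.c₆ / V.c₆) * (V.c₄ / W.c₄) : ℚ) : ℚ_[p])‖ ≤ (p : ℝ)⁻¹ := by
  have hu := norm_inv_u_le_one_of_twist W V C hd hΔ hC
  rw [twistRatio_eq W V C hC h4 h6]
  push_cast
  rw [norm_mul, norm_pow, hd]
  calc ‖((((C.u : ℚˣ) : ℚ) : ℚ_[p]))⁻¹‖ ^ 2 * (p : ℝ)⁻¹ ≤ 1 ^ 2 * (p : ℝ)⁻¹ := by gcongr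
    _ = (p : ℝ)⁻¹ := by rw [one_pow, one_mul]

end Twist

/-! ### §3 `‖c_E‖_p ≤ 1` on the census scope -/

section Census

variable {p : ℕ} [Fact p.Prime]

/-- `‖±p‖_p = p⁻¹`. [folklore] -/
theorem norm_ratCast_prime_or_neg {d : ℚ} (hd : d = p ∨ d = -(p : ℚ)) : ‖(d : ℚ_[p])‖ = (p : ℝ)⁻¹ := by
  rcases hd with rfl | rfl
  · push_cast; exact Padic.norm_p
  · push_cast; rw [norm_neg]; exact Padic.norm_p

/-- **THE TRANSPORTED MAZUR–TATE CONSTANT IS `p`-INTEGRAL on the census scope.** For `p ≥ 5`, `W/ℚ`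
with integer coefficients and `c₄(W) ≠ 0`, `c₆(W) ≠ 0` (`j ≠ 0, 1728`), `V/ℚ` globally minimal with good
reduction at `p`, and a variable change `C` with `C • V^{(p)} = W` or `C • V^{(−p)} = W`:
`‖CensusX42.transportedSigmaConst W p V‖_p ≤ 1`
(`c_E = U²·(c_{E♭} − b₂(E♭)/12) + b₂(E)/12`, `‖U²‖ ≤ p⁻¹`, `c_{E♭}, b₂/12 ∈ ℤ_p`). Hence the level-one
σ_{c_E}-datum of the lane exists on the whole scope of `CensusX42.RelationAtCensusHeight`.
[Mazur–Stein–Tate 2006, Thm. 1.3; census X42-STEP0 §3] [cite: MazurSteinTate2006, Thm. 1.3] -/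
theorem norm_transportedSigmaConst_le_one (hp5 : 5 ≤ p) (W : WeierstrassCurve ℚ) [W.IsIntegral ℤ]
    (h4 : W.c₄ ≠ 0) (h6 : W.c₆ ≠ 0) (V : WeierstrassCurve ℚ) [V.IsGloballyMinimal]
    (hgood : V.HasGoodReductionAtPrime p) (C : VariableChange ℚ)
    (hC : C • V.quadraticTwist (p : ℚ) = W ∨ C • V.quadraticTwist (-(p : ℚ)) = W) :
    ‖CensusX42.transportedSigmaConst W p V‖ ≤ 1 := by
  have hΔ := norm_ratCast_Δ_eq_one_of_hasGoodReductionAtPrime (p := p) V hgood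
  have hU : ‖(((W.c₆ / V.c₆) * (V.c₄ / W.c₄) : ℚ) : ℚ_[p])‖ ≤ 1 := by
    have hp1 : (p : ℝ)⁻¹ ≤ 1 := inv_le_one_of_one_le₀ (by exact_mod_cast (Fact.out : p.Prime).one_le)
    rcases hC with hC | hC
    · exact (norm_twistRatio_le W V C (norm_ratCast_prime_or_neg (Or.inl rfl)) hΔ hC h4 h6).trans hp1
    · exact (norm_twistRatio_le W V C (norm_ratCast_prime_or_neg (Or.inr rfl)) hΔ hC h4 h6).trans hp1
  have hcV := norm_padicSigmaConst_le_one (V.baseChange ℚ_[p])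
  have hbV := norm_ratCast_b₂_div_twelve_le_one hp5 V
  have hbW := norm_ratCast_b₂_div_twelve_le_one hp5 W
  unfold CensusX42.transportedSigmaConst
  refine (Padic.nonarchimedean _ _).trans (max_le ?_ hbW)
  rw [norm_mul]
  refine mul_le_one₀ hU (norm_nonneg _) ?_
  rw [sub_eq_add_neg]
  exact (Padic.nonarchimedean _ _).trans (max_le hcV (by rw [norm_neg]; exact hbV))

end Census

end Summit.BirchSwinnertonDyer.BirchSwinnertonDyer.Theorems.PSSigmaLineFamilyTransportedConstant

end
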